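import Summits.QuantumFields.YangMills.Theorems.BalabanUVNodesN15KingModelFreePropagatorComparison
import Mathlib.Analysis.SpecialFunctions.Gaussian.GaussianIntegral
import Mathlib.Analysis.SpecialFunctions.ImproperIntegrals
import Mathlib.MeasureTheory.Integral.IntegralEqImproper

/-!
# BalabanUVNodes ∕ N15 — THE KING-MODEL RUNG (PART Ϻ-u): BOUNDS UNIFORM IN THE MASS IN `d + 1 ≥ 3` DIMENSIONS — the massless free propagator in closed form
# `∫₀^∞k_t(R)dt = Γ((d−1)∕2)∕(4π^{(d+1)∕2}R^{d−1})`, the scale-free power-law bound `S₂^{ℝ}(z) ≤ Γ((d−1)∕2)∕(4π^{(d+1)∕2}R₋(z)^{d−1})` for EVERY `m > 0` (Coulomb `1∕(4πR₋)` in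
# three dimensions), and the global bound `S₂^{ℝ}(z) ≤ 3` uniformly in `m`, `z` and `d ≥ 2` — the infrared finiteness of King's block field in the massless limit
# (Track A, DAG node N15 = NE2; FAN-OUT v1.1 §N15 s3 «KING-MODEL RUNG»; builds on parts Ϻ-a∕b∕c; count-neutral)

HONEST FRAMING.  Count-neutral (cell `pub-ymgap`, seat `pub-ymgap-dag-n15-e` g35; `--supports stmt-QuantumFields-27366 --as helper` = K3⁸).  King's `A = 0`, `g = 0` model
([King1986] C. King, Commun. Math. Phys. **102** (1986) 649–677).  Part Ϻ-c sandwiched King's continuum block two-point function between continuum free propagators,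
`S₂^{ℝ}(z) ≤ C_m(R₋(z)) = ∫₀^∞e^{−tm²}k_t(R₋(z))dt`.  In `d + 1 ≥ 3` dimensions the heat kernel `k_t(R) = (4πt)^{−(d+1)∕2}e^{−R²∕4t}` is integrable in `t ∈ (0,∞)` WITHOUT the
mass damping, and the substitution `t ↦ 1∕t` evaluates the massless propagator by Euler's integral:
★★ `∫₀^∞k_t(R)dt = Γ((d−1)∕2)∕(4π^{(d+1)∕2}R^{d−1})` (`R > 0`, `d ≥ 2`).  Consequences, all UNIFORM IN THE MASS `m > 0`: ★★★ the scale-free bound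
`S₂^{ℝ}(z) ≤ Γ((d−1)∕2)∕(4π^{(d+1)∕2}R₋(z)^{d−1})` whenever the blocks are separated (`R₋(z) > 0`) — King's massless power law, in three dimensions exactly the Coulomb
potential `S₂^{ℝ}(z) ≤ 1∕(4πR₋(z))` — and ★★ the GLOBAL bound `0 < S₂^{ℝ}(z) ≤ 3` for every `z`, every `m > 0`, every `d ≥ 2` (tent form of part Ϻ-b: the integrand is `≤ 1` on
`(0,1]` and `≤ t^{−3∕2}` on `(1,∞)`): the block field stays bounded in the infrared ∕ massless limit, the fact behind block-spin renormalisation of massless fields in `d + 1 ≥ 3`.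
NOT Bałaban's objects; NOT a node discharge; nothing continuum-Yang–Mills ∕ `ℝ⁴` ∕ OS ∕ Clay.  0 `sorry`, 0 def; standard axioms.

WHAT THIS FILE PROVES (kernel).  §1 `inv_sqrt_pow_eq_rpow`, `heatRadial_eq_rpow`, `integrableOn_rpow_neg_mul_exp_neg_div`, ★ `integral_rpow_neg_mul_exp_neg_div`
(`∫₀^∞t^{−s}e^{−c∕t}dt = c^{1−s}Γ(s−1)`), ★ `integrableOn_heatRadial`, ★★ **`integral_heatRadial`** (the massless propagator in closed form).  §2 `freePropRadial_le_integral_heatRadial`,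
★★★ **`kingS2Inf_le_massless`**, ★★ **`kingS2Inf_le_inv_four_pi_mul`** (`d = 2`: `S₂^{ℝ} ≤ 1∕(4πR₋)`).  §3 `tentAvg_le_one`, `prod_tentAvg_le_one`, `prod_tentAvg_le_inv_sqrt_pow`,
`inv_sqrt_pow_le_rpow_of_one_lt`, ★★ **`kingS2Inf_le_three`** (`S₂^{ℝ}(z) ≤ 3` uniformly), `kingS2Inf_mem_Ioc`.

HONEST SCOPE.  King's free `K = |Ω| = ∞` block field, `d + 1 ≥ 3`; the massless field itself (`m = 0`) is not constructed here — only mass-uniform bounds.  N15 untouched; counts unmoved.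
Locators (use): [King1986] Thm 2.1 (2.22) p.654, (4.5)–(4.8) pp.670–671.
-/

noncomputable section

open scoped BigOperators Topology
open Filter MeasureTheory Set

namespace Summit.QuantumFields.YangMills.BalabanUVNodes.N15KingModelRung.ProperTime

open Summit.QuantumFields.YangMills.BalabanUVNodes.N15KingModelRung.OptimalDecay
open Literature.Analysis.Fourier (tent tent_nonneg)

variable {d : ℕ}

/-! ## §1 The massless free propagator in closed form -/

/-- `(√x)⁻ⁿ = x^{−n∕2}` (`x ≥ 0`). [folklore] -/
theorem inv_sqrt_pow_eq_rpow {x : ℝ} (hx : 0 ≤ x) (n : ℕ) : (Real.sqrt x)⁻¹ ^ n = x ^ (-((n : ℝ) / 2)) := by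
  rw [Real.sqrt_eq_rpow, ← Real.rpow_neg hx, ← Real.rpow_natCast, ← Real.rpow_mul hx]
  congr 1
  ring

/-- The heat kernel in power form: `k_t(R) = (4π)^{−(d+1)∕2}·t^{−(d+1)∕2}e^{−R²∕4t}` (`t > 0`). [folklore] -/
theorem heatRadial_eq_rpow {t : ℝ} (ht : 0 < t) (R : ℝ) :
    heatRadial d t R = (4 * Real.pi) ^ (-(((d : ℝ) + 1) / 2)) * (t ^ (-(((d : ℝ) + 1) / 2)) * Real.exp (-(R ^ 2 / (4 * t)))) := by
  have h4 : 0 ≤ 4 * Real.pi := by positivity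
  unfold heatRadial
  rw [inv_sqrt_pow_eq_rpow (mul_nonneg h4 ht.le), Real.mul_rpow h4 ht.le, mul_assoc]
  push_cast
  ring

/-- The substitution `t ↦ 1∕t`, pointwise. [folklore] -/
private theorem subst_pointwise {s c t : ℝ} (ht : 0 < t) :
    (|(-1 : ℝ)| * t ^ ((-1 : ℝ) - 1)) • ((t ^ (-1 : ℝ)) ^ (s - 1 - 1) * Real.exp (-(c * t ^ (-1 : ℝ)))) = t ^ (-s) * Real.exp (-(c / t)) := by
  rw [smul_eq_mul, ← Real.rpow_mul ht.le, Real.rpow_neg_one, abs_neg, abs_one, one_mul, ← mul_assoc, ← Real.rpow_add ht, div_eq_mul_inv,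
    show (-1 : ℝ) - 1 + -1 * (s - 1 - 1) = -s by ring]

/-- `t ↦ t^{−s}e^{−c∕t}` is integrable on `(0,∞)` for `s > 1`, `c > 0`. [folklore] -/
theorem integrableOn_rpow_neg_mul_exp_neg_div {s c : ℝ} (hs : 1 < s) (hc : 0 < c) :
    IntegrableOn (fun t : ℝ => t ^ (-s) * Real.exp (-(c / t))) (Ioi 0) := by
  have hg : IntegrableOn (fun y : ℝ => y ^ (s - 1 - 1) * Real.exp (-(c * y))) (Ioi 0) := by
    have h := integrableOn_rpow_mul_exp_neg_mul_rpow (s := s - 1 - 1) (p := 1) (b := c) (by linarith) le_rfl hc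
    refine h.congr_fun (fun y _ => ?_) measurableSet_Ioi
    simp only [Real.rpow_one, neg_mul]
  have key := (integrableOn_Ioi_comp_rpow_iff (fun y : ℝ => y ^ (s - 1 - 1) * Real.exp (-(c * y))) (p := (-1 : ℝ)) (by norm_num)).mpr hg
  exact key.congr_fun (fun t ht => subst_pointwise ht) measurableSet_Ioi

/-- ★ **Euler's integral after `t ↦ 1∕t`**: `∫₀^∞t^{−s}e^{−c∕t}dt = (1∕c)^{s−1}Γ(s−1)` (`s > 1`, `c > 0`). [folklore] -/
theorem integral_rpow_neg_mul_exp_neg_div {s c : ℝ} (hs : 1 < s) (hc : 0 < c) :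
    ∫ t in Ioi (0 : ℝ), t ^ (-s) * Real.exp (-(c / t)) = (1 / c) ^ (s - 1) * Real.Gamma (s - 1) := by
  rw [← Real.integral_rpow_mul_exp_neg_mul_Ioi (by linarith : 0 < s - 1) hc,
    ← integral_comp_rpow_Ioi (fun y : ℝ => y ^ (s - 1 - 1) * Real.exp (-(c * y))) (p := (-1 : ℝ)) (by norm_num)]
  exact setIntegral_congr_fun measurableSet_Ioi fun t ht => (subst_pointwise ht).symm

/-- ★ **The heat kernel is integrable in proper time without mass damping** in `d + 1 ≥ 3` dimensions (`R > 0`). [folklore] -/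
theorem integrableOn_heatRadial {R : ℝ} (hd : 2 ≤ d) (hR : 0 < R) : IntegrableOn (fun t : ℝ => heatRadial d t R) (Ioi 0) := by
  have hd' : (2 : ℝ) ≤ d := by exact_mod_cast hd
  have h : IntegrableOn (fun t : ℝ => (4 * Real.pi) ^ (-(((d : ℝ) + 1) / 2)) * (t ^ (-(((d : ℝ) + 1) / 2)) * Real.exp (-(R ^ 2 / 4 / t)))) (Ioi 0) :=
    (integrableOn_rpow_neg_mul_exp_neg_div (s := ((d : ℝ) + 1) / 2) (c := R ^ 2 / 4) (by linarith) (by positivity)).const_mul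
      ((4 * Real.pi) ^ (-(((d : ℝ) + 1) / 2)))
  refine IntegrableOn.congr_fun h (fun t ht => ?_) measurableSet_Ioi
  have ht : 0 < t := ht
  rw [heatRadial_eq_rpow ht, div_div]

/-- ★★ **THE MASSLESS FREE PROPAGATOR IN CLOSED FORM**: `∫₀^∞k_t(R)dt = Γ((d−1)∕2)∕(4π^{(d+1)∕2}R^{d−1})` for `d ≥ 2`, `R > 0` — the Green's function of `−Δ` on `ℝ^{d+1}` at distance `R`.
[folklore] -/
theorem integral_heatRadial {R : ℝ} (hd : 2 ≤ d) (hR : 0 < R) :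
    ∫ t in Ioi (0 : ℝ), heatRadial d t R = Real.Gamma (((d : ℝ) - 1) / 2) / (4 * Real.pi ^ (((d : ℝ) + 1) / 2) * R ^ (d - 1)) := by
  have hd' : (2 : ℝ) ≤ d := by exact_mod_cast hd
  have hcast : ((d - 1 : ℕ) : ℝ) = (d : ℝ) - 1 := by
    rw [Nat.cast_sub (by omega : 1 ≤ d), Nat.cast_one]
  set s : ℝ := ((d : ℝ) + 1) / 2 with hs_def
  have hs : 1 < s := by rw [hs_def]; linarith
  have hc : 0 < R ^ 2 / 4 := by positivity
  have step1 : ∫ t in Ioi (0 : ℝ), heatRadial d t R = (4 * Real.pi) ^ (-s) * ∫ t in Ioi (0 : ℝ), t ^ (-s) * Real.exp (-(R ^ 2 / 4 / t)) := by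
    rw [← integral_const_mul]
    refine setIntegral_congr_fun measurableSet_Ioi fun t ht => ?_
    have ht : 0 < t := ht
    rw [heatRadial_eq_rpow ht, div_div]
  rw [step1, integral_rpow_neg_mul_exp_neg_div hs hc]
  -- constant algebra
  have h4 : (0 : ℝ) ≤ 4 := by norm_num
  have hπ := Real.pi_pos
  have hR2 : (R ^ 2) ^ (s - 1) = R ^ (d - 1) := by
    rw [← Real.rpow_natCast R 2, ← Real.rpow_mul hR.le, ← Real.rpow_natCast R (d - 1), hcast]
    congr 1
    rw [hs_def]; push_cast; ring
  have hGam : Real.Gamma (s - 1) = Real.Gamma (((d : ℝ) - 1) / 2) := by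
    congr 1; rw [hs_def]; ring
  have hfour : (4 : ℝ) ^ (-s) * 4 ^ (s - 1) = 4⁻¹ := by
    rw [← Real.rpow_add (by norm_num : (0 : ℝ) < 4), show -s + (s - 1) = (-1 : ℝ) by ring, Real.rpow_neg_one]
  have hpi : Real.pi ^ (-s) = (Real.pi ^ s)⁻¹ := Real.rpow_neg hπ.le s
  have hps : 0 < Real.pi ^ s := Real.rpow_pos_of_pos hπ s
  have hRd : 0 < R ^ (d - 1) := pow_pos hR _
  rw [one_div_div, Real.mul_rpow h4 hπ.le, Real.div_rpow h4 (sq_nonneg R), hR2, hGam, hpi]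
  calc (4 : ℝ) ^ (-s) * (Real.pi ^ s)⁻¹ * (4 ^ (s - 1) / R ^ (d - 1) * Real.Gamma ((↑d - 1) / 2))
      = (4 : ℝ) ^ (-s) * 4 ^ (s - 1) * ((Real.pi ^ s)⁻¹ / R ^ (d - 1) * Real.Gamma ((↑d - 1) / 2)) := by ring
    _ = Real.Gamma ((↑d - 1) / 2) / (4 * Real.pi ^ s * R ^ (d - 1)) := by
        rw [hfour]
        field_simp

/-! ## §2 The scale-free bound on `S₂^{ℝ}`, uniform in the mass -/

/-- `C_m(R) ≤ C_0(R) = ∫₀^∞k_t(R)dt` (`d ≥ 2`, `R > 0`, `m² > 0`). [folklore] -/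
theorem freePropRadial_le_integral_heatRadial {m2 R : ℝ} (hd : 2 ≤ d) (hm : 0 < m2) (hR : 0 < R) :
    freePropRadial d m2 R ≤ ∫ t in Ioi (0 : ℝ), heatRadial d t R := by
  unfold freePropRadial
  refine setIntegral_mono_on (integrableOn_exp_mul_heatRadial hm hR) (integrableOn_heatRadial hd hR) measurableSet_Ioi fun t ht => ?_
  have ht : 0 < t := ht
  calc Real.exp (-(t * m2)) * heatRadial d t R ≤ 1 * heatRadial d t R :=
        mul_le_mul_of_nonneg_right (Real.exp_le_one_iff.mpr (by nlinarith [mul_pos ht hm])) (heatRadial_nonneg _ _)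
    _ = heatRadial d t R := one_mul _

/-- ★★★ **KING'S MASSLESS POWER LAW, UNIFORM IN THE MASS**: in `d + 1 ≥ 3` dimensions, for every `m² > 0` and every `z` with separated blocks (`R₋(z) > 0`),
`S₂^{ℝ}(z) ≤ Γ((d−1)∕2)∕(4π^{(d+1)∕2}·R₋(z)^{d−1})` — the scale-free (canonical-dimension) decay of the block two-point function. [cite: King1986, Thm 2.1 (2.22) p.654, (4.5) p.670] -/
theorem kingS2Inf_le_massless {m2 : ℝ} (hd : 2 ≤ d) (hm : 0 < m2) {z : Fin (d + 1) → ℤ} (hgap : 0 < blockGap z) :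
    kingS2Inf m2 z ≤ Real.Gamma (((d : ℝ) - 1) / 2) / (4 * Real.pi ^ (((d : ℝ) + 1) / 2) * blockGap z ^ (d - 1)) := by
  rw [← integral_heatRadial hd hgap]
  exact (kingS2Inf_le_freePropRadial hm hgap).trans (freePropRadial_le_integral_heatRadial hd hm hgap)

/-- ★★ **THREE DIMENSIONS: THE COULOMB BOUND** — for `d + 1 = 3`, every `m² > 0` and separated blocks, `S₂^{ℝ}(z) ≤ 1∕(4πR₋(z))` (`Γ(1∕2) = √π`). [cite: King1986, Thm 2.1 (2.22) p.654] -/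
theorem kingS2Inf_le_inv_four_pi_mul {m2 : ℝ} (hm : 0 < m2) {z : Fin (2 + 1) → ℤ} (hgap : 0 < blockGap z) :
    kingS2Inf m2 z ≤ (4 * Real.pi * blockGap z)⁻¹ := by
  have h := kingS2Inf_le_massless (d := 2) le_rfl hm hgap
  have hπ := Real.pi_pos
  have e1 : Real.Gamma ((((2 : ℕ) : ℝ) - 1) / 2) = Real.sqrt Real.pi := by
    rw [← Real.Gamma_one_half_eq]; norm_num
  have e2 : Real.pi ^ ((((2 : ℕ) : ℝ) + 1) / 2) = Real.pi * Real.sqrt Real.pi := by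
    rw [show ((((2 : ℕ) : ℝ) + 1) / 2) = 1 + 1 / 2 by norm_num, Real.rpow_add hπ, Real.rpow_one, Real.sqrt_eq_rpow]
  rw [e1, e2, show (2 - 1 : ℕ) = 1 from rfl, pow_one] at h
  have hs : 0 < Real.sqrt Real.pi := Real.sqrt_pos.mpr hπ
  calc kingS2Inf m2 z ≤ Real.sqrt Real.pi / (4 * (Real.pi * Real.sqrt Real.pi) * blockGap z) := h
    _ = (4 * Real.pi * blockGap z)⁻¹ := by
        field_simp

/-! ## §3 The global bound `S₂^{ℝ} ≤ 3`, uniform in the mass -/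

/-- `J_t(x) = ∫Λ(u)g_t(x−u)du ≤ 1`. [folklore] -/
theorem tentAvg_le_one {t : ℝ} (ht : 0 < t) (x : ℝ) : ∫ u : ℝ, tent 1 u * gaussLine t (x - u) ≤ 1 := by
  rw [tentAvg_eq_lineHeat_div ht, div_le_one (by positivity)]
  exact lineHeat_le_two_pi ht x

/-- `∏_μJ_t(z_μ) ≤ 1`. [folklore] -/
theorem prod_tentAvg_le_one {t : ℝ} (ht : 0 < t) (z : Fin (d + 1) → ℤ) : ∏ μ, ∫ u : ℝ, tent 1 u * gaussLine t ((z μ : ℝ) - u) ≤ 1 :=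
  Finset.prod_le_one (fun _ _ => tentAvg_nonneg _ _) fun _ _ => tentAvg_le_one ht _

/-- `∏_μJ_t(z_μ) ≤ (4πt)^{−(d+1)∕2}` (each factor is at most the peak `g_t(0)`). [folklore] -/
theorem prod_tentAvg_le_inv_sqrt_pow {t : ℝ} (ht : 0 < t) (z : Fin (d + 1) → ℤ) :
    ∏ μ, ∫ u : ℝ, tent 1 u * gaussLine t ((z μ : ℝ) - u) ≤ (Real.sqrt (4 * Real.pi * t))⁻¹ ^ (d + 1) := by
  calc ∏ μ, ∫ u : ℝ, tent 1 u * gaussLine t ((z μ : ℝ) - u) ≤ ∏ _μ : Fin (d + 1), (Real.sqrt (4 * Real.pi * t))⁻¹ :=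
        Finset.prod_le_prod (fun _ _ => tentAvg_nonneg _ _) fun _ _ =>
          (tentAvg_le_gaussLine_posPart ht _).trans ((gaussLine_le_zero_val ht _).trans_eq (gaussLine_zero t))
    _ = (Real.sqrt (4 * Real.pi * t))⁻¹ ^ (d + 1) := by rw [Finset.prod_const, Finset.card_univ, Fintype.card_fin]

/-- For `t > 1` and `d ≥ 2`: `(4πt)^{−(d+1)∕2} ≤ t^{−3∕2}`. [folklore] -/
theorem inv_sqrt_pow_le_rpow_of_one_lt {t : ℝ} (hd : 2 ≤ d) (ht : 1 < t) : (Real.sqrt (4 * Real.pi * t))⁻¹ ^ (d + 1) ≤ t ^ (-(3 / 2 : ℝ)) := by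
  have ht0 : 0 < t := by linarith
  have hπ : 1 ≤ 4 * Real.pi := by nlinarith [Real.pi_gt_three]
  have hst : 1 ≤ Real.sqrt t := Real.one_le_sqrt.mpr ht.le
  have hmono : Real.sqrt t ≤ Real.sqrt (4 * Real.pi * t) := Real.sqrt_le_sqrt (by nlinarith)
  have hx1 : (Real.sqrt (4 * Real.pi * t))⁻¹ ≤ 1 := inv_le_one_of_one_le₀ (hst.trans hmono)
  have hx0 : 0 ≤ (Real.sqrt (4 * Real.pi * t))⁻¹ := inv_nonneg.mpr (Real.sqrt_nonneg _)
  calc (Real.sqrt (4 * Real.pi * t))⁻¹ ^ (d + 1) ≤ (Real.sqrt (4 * Real.pi * t))⁻¹ ^ 3 := pow_le_pow_of_le_one hx0 hx1 (by omega)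
    _ ≤ (Real.sqrt t)⁻¹ ^ 3 := pow_le_pow_left₀ hx0 ((inv_le_inv₀ (by positivity) (by positivity)).mpr hmono) 3
    _ = t ^ (-(3 / 2 : ℝ)) := by rw [inv_sqrt_pow_eq_rpow ht0.le 3]; norm_num

/-- ★★ **THE GLOBAL BOUND, UNIFORM IN THE MASS**: in `d + 1 ≥ 3` dimensions, `S₂^{ℝ}(z) ≤ 3` for every `z` and every `m² > 0` (tent form: the proper-time integrand is `≤ 1` on `(0,1]` and
`≤ t^{−3∕2}` on `(1,∞)`) — King's block field is bounded in the infrared ∕ massless limit. [cite: King1986, Thm 2.1 (2.22)–(2.23) p.654, (4.8) p.671] -/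
theorem kingS2Inf_le_three {m2 : ℝ} (hd : 2 ≤ d) (hm : 0 < m2) (z : Fin (d + 1) → ℤ) : kingS2Inf m2 z ≤ 3 := by
  rw [kingS2Inf_eq_integral_tent_gaussLine hm z]
  set f : ℝ → ℝ := fun t => Real.exp (-(t * m2)) * ∏ μ, ∫ u : ℝ, tent 1 u * gaussLine t ((z μ : ℝ) - u) with hf
  have hfi : IntegrableOn f (Ioi 0) := integrableOn_tentForm hm z
  have hexp : ∀ t, 0 < t → Real.exp (-(t * m2)) ≤ 1 := fun t ht => Real.exp_le_one_iff.mpr (by nlinarith [mul_pos ht hm])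
  have hf1 : ∀ t, 0 < t → f t ≤ 1 := fun t ht => by
    calc f t ≤ 1 * 1 := mul_le_mul (hexp t ht) (prod_tentAvg_le_one ht z) (Finset.prod_nonneg fun _ _ => tentAvg_nonneg _ _) zero_le_one
      _ = 1 := one_mul _
  have hf2 : ∀ t, 1 < t → f t ≤ t ^ (-(3 / 2 : ℝ)) := fun t ht => by
    have ht0 : 0 < t := by linarith
    calc f t ≤ 1 * (Real.sqrt (4 * Real.pi * t))⁻¹ ^ (d + 1) :=
          mul_le_mul (hexp t ht0) (prod_tentAvg_le_inv_sqrt_pow ht0 z) (Finset.prod_nonneg fun _ _ => tentAvg_nonneg _ _) zero_le_one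
      _ ≤ t ^ (-(3 / 2 : ℝ)) := by rw [one_mul]; exact inv_sqrt_pow_le_rpow_of_one_lt hd ht
  rw [← Ioc_union_Ioi_eq_Ioi zero_le_one, setIntegral_union Ioc_disjoint_Ioi_same measurableSet_Ioi (hfi.mono_set Ioc_subset_Ioi_self)
    (hfi.mono_set (Ioi_subset_Ioi zero_le_one))]
  have h1 : ∫ t in Ioc (0 : ℝ) 1, f t ≤ 1 := by
    calc ∫ t in Ioc (0 : ℝ) 1, f t ≤ ∫ _ in Ioc (0 : ℝ) 1, (1 : ℝ) :=
          setIntegral_mono_on (hfi.mono_set Ioc_subset_Ioi_self) (integrableOn_const (by simp)) measurableSet_Ioc fun t ht => hf1 t ht.1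
      _ = 1 := by rw [setIntegral_const, Real.volume_real_Ioc_of_le zero_le_one]; simp
  have h2 : ∫ t in Ioi (1 : ℝ), f t ≤ 2 := by
    calc ∫ t in Ioi (1 : ℝ), f t ≤ ∫ t in Ioi (1 : ℝ), t ^ (-(3 / 2 : ℝ)) :=
          setIntegral_mono_on (hfi.mono_set (Ioi_subset_Ioi zero_le_one)) (integrableOn_Ioi_rpow_of_lt (by norm_num) one_pos) measurableSet_Ioi
            fun t ht => hf2 t ht
      _ = 2 := by rw [integral_Ioi_rpow_of_lt (by norm_num) one_pos, Real.one_rpow]; norm_num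
  linarith

/-- ★ `0 < S₂^{ℝ}(z) ≤ 3` for every `z`, `m² > 0`, `d ≥ 2`. [cite: King1986, Thm 2.1 (2.22)–(2.23) p.654] -/
theorem kingS2Inf_mem_Ioc {m2 : ℝ} (hd : 2 ≤ d) (hm : 0 < m2) (z : Fin (d + 1) → ℤ) : kingS2Inf m2 z ∈ Ioc (0 : ℝ) 3 :=
  ⟨kingS2Inf_pos hm z, kingS2Inf_le_three hd hm z⟩

end Summit.QuantumFields.YangMills.BalabanUVNodes.N15KingModelRung.ProperTime
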